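/-
Copyright: the b2b-balaban cell (near-miss cell 7), T⁴-continuum fan-out, lineage t4-ne7b-p1 (node U5c COUNT member).
Released under the licence of the surrounding project.
-/
import Summits.QuantumFields.BalabanUV.T4Continuum.Support.PlacementBatch

/-!
# Crowding budget (crowding theorem, part 1): distinct pairs sum superlinearly

Summits-side support leaf of the T⁴-continuum cell (rung (B)+1 on a FINITE torus only; NOT infinite volume, NOT the
mass gap, NOT the Clay statement; NOT a proof of the spine estimate NE7b).  Lineage `t4-ne7b-p1`, node U5c, wall (GM)
of the cell's gap census, located item G-ne7bp1g18-2 part (II): in the ZONE form of the placement assembly (one term per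
merger, no pair sum) the combinatorial factor of a merger is governed by how many formation events (births, mergers) of
the two merging structures are RECENT; along `m` old separated pieces chain-merged at one step this is `≍ (m!)^d` with
no same-step births around to pay for it.  What pays is the AGES: the younger roots of those `m` mergers are `m` DISTINCT
births, so their `(step, class)` pairs are distinct, and distinct pairs of naturals sum SUPERLINEARLY.  This file is the
[folklore] counting behind that sentence; the crowding theorem itself (cost `Σ_mergers p·log q` against
`θ·Σ_births (d′+1) + ε·partnerAges`) is assembled in later parts.  Nothing is quoted from print; nothing printed is
asserted; no `[cite:]` tag.

CONTENTS.  §1 `mul_card_sub_sq_le_sum`: for a finite set `S` of pairs of naturals and every `R`,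
`(R+1)·(#S − R²) ≤ Σ_{(a,f) ∈ S} (a + f + 1)` (the pairs with `a + f < R` are at most `R²`; every other pair contributes
`≥ R + 1`).  §2 `card_mul_sqrt_le_sum`: the choice `R = ⌊√(#S∕2)⌋` gives `#S·√#S ∕ (2√2) ≤ Σ (a + f + 1)`.
§3 `card_mul_sqrt_le_sum_fat_birthsAt`: births of one genealogy at one step have distinct classes
(`PlacementBatch.fat_injOn_birthsAt`), hence `n·√n∕(2√2) ≤ Σ_{births at t} (d′ + 1)`.  §4 `youngerRoot_budget`: if the
mergers `Ms` at step `s` come with an INJECTIVE assignment `y` of births with `(y e).step ≤ s + 1` (in the chain: the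
younger root of the merger), then
`min(ε, θ∕2) · #Ms·√#Ms∕(2√2) ≤ Σ_{e ∈ Ms} (ε·(s + 1 − step (y e)) + (θ∕2)·(fat (y e) + 1))` — the age half is what
`partnerAges` pays (rate `ε`), the class half is half the quadratic birth credit (rate `θ∕2`, parts 3∕3b).  §5 sanity.

HONEST DEPENDENCY (cell): continuum YM on T⁴ ⇐ BetaPertH ∧ nine spine estimates (0/9 proved); BetaPertH ⇐ (D1) ∧ (D4)
∧ CAP+tail.  This file changes none of it.
-/

namespace Summit.QuantumFields.BalabanUV.T4Continuum.Crowding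

open Finset
open Literature.MathematicalPhysics.QuantumFieldTheory.Balaban1983to89
open Literature.MathematicalPhysics.QuantumFieldTheory.Balaban1983to89.T4PersistenceDictionary
open Summit.QuantumFields.BalabanUV.T4Continuum.PlacementBatch

noncomputable section

/-! ## §1 Distinct pairs of naturals -/

/-- Pairs with small sum are few: `#{(a,f) ∈ S : a + f < R} ≤ R²`. [folklore] -/
theorem card_filter_add_lt_le (S : Finset (ℕ × ℕ)) (R : ℕ) :
    (S.filter fun x => x.1 + x.2 < R).card ≤ R ^ 2 := by
  calc (S.filter fun x => x.1 + x.2 < R).card ≤ (range R ×ˢ range R).card := by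
        refine card_le_card fun x hx => ?_
        have hx' := (mem_filter.1 hx).2
        rw [mem_product, mem_range, mem_range]
        omega
    _ = R ^ 2 := by rw [card_product, card_range, sq]

/-- **DISTINCT PAIRS LEMMA.**  For a finite set `S` of pairs of naturals and every `R : ℕ`:
`(R + 1)·(#S − R²) ≤ Σ_{(a,f) ∈ S} (a + f + 1)` (truncated subtraction). [folklore] -/
theorem mul_card_sub_sq_le_sum (S : Finset (ℕ × ℕ)) (R : ℕ) :
    (R + 1) * (S.card - R ^ 2) ≤ ∑ x ∈ S, (x.1 + x.2 + 1) := by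
  set S' := S.filter fun x => x.1 + x.2 < R with hS'
  have h1 : S.card - R ^ 2 ≤ (S \ S').card := by
    have h := card_sdiff_add_card_eq_card (filter_subset (fun x => x.1 + x.2 < R) S)
    have h' := card_filter_add_lt_le S R
    rw [← hS'] at h h'
    omega
  calc (R + 1) * (S.card - R ^ 2) ≤ (R + 1) * (S \ S').card := Nat.mul_le_mul_left _ h1
    _ = ∑ _x ∈ S \ S', (R + 1) := by rw [sum_const, smul_eq_mul, mul_comm]
    _ ≤ ∑ x ∈ S \ S', (x.1 + x.2 + 1) := sum_le_sum fun x hx => by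
        simp only [hS', mem_sdiff, mem_filter, not_and, not_lt] at hx
        have := hx.2 hx.1
        omega
    _ ≤ ∑ x ∈ S, (x.1 + x.2 + 1) := sum_le_sum_of_subset_of_nonneg sdiff_subset fun _ _ _ => Nat.zero_le _

/-! ## §2 The superlinear corollary -/

/-- `m ≤ 2·⌊m∕2⌋ + 1`, in `ℝ`. [folklore] -/
theorem cast_le_two_mul_div_two_add_one (m : ℕ) : (m : ℝ) ≤ 2 * ((m / 2 : ℕ) : ℝ) + 1 := by
  have h := Nat.div_add_mod m 2
  have h2 := Nat.mod_lt m (by norm_num : 0 < 2)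
  have : (m : ℝ) = 2 * ((m / 2 : ℕ) : ℝ) + ((m % 2 : ℕ) : ℝ) := by exact_mod_cast h.symm
  rw [this]
  have : ((m % 2 : ℕ) : ℝ) ≤ 1 := by exact_mod_cast Nat.lt_succ_iff.1 h2
  linarith

/-- **SUPERLINEARITY.**  `#S·√#S ∕ (2√2) ≤ Σ_{(a,f) ∈ S} (a + f + 1)` for every finite set `S` of pairs of naturals
(the distinct pairs lemma at `R = ⌊√(#S∕2)⌋`). [folklore] -/
theorem card_mul_sqrt_le_sum (S : Finset (ℕ × ℕ)) :
    (S.card : ℝ) * Real.sqrt S.card / (2 * Real.sqrt 2) ≤ ∑ x ∈ S, ((x.1 + x.2 + 1 : ℕ) : ℝ) := by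
  set m := S.card with hm
  set R := Nat.sqrt (m / 2) with hR
  have key := mul_card_sub_sq_le_sum S R
  rw [← hm] at key
  have hR2 : R ^ 2 ≤ m / 2 := Nat.sqrt_le' (m / 2)
  have hR1 : m / 2 < (R + 1) ^ 2 := Nat.lt_succ_sqrt' (m / 2)
  -- the two real inequalities
  have hsub : (m : ℝ) / 2 ≤ ((m - R ^ 2 : ℕ) : ℝ) := by
    have h1 : m - m / 2 ≤ m - R ^ 2 := Nat.sub_le_sub_left hR2 m
    have h2 : ((m / 2 : ℕ) : ℝ) ≤ (m : ℝ) / 2 := Nat.cast_div_le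
    have h3 : ((m - m / 2 : ℕ) : ℝ) = (m : ℝ) - ((m / 2 : ℕ) : ℝ) := Nat.cast_sub (Nat.div_le_self m 2)
    have h4 : ((m - m / 2 : ℕ) : ℝ) ≤ ((m - R ^ 2 : ℕ) : ℝ) := by exact_mod_cast h1
    linarith
  have hroot : Real.sqrt m / Real.sqrt 2 ≤ (R : ℝ) + 1 := by
    rw [← Real.sqrt_div (Nat.cast_nonneg m) 2]
    have h1 : (m : ℝ) / 2 ≤ ((R : ℝ) + 1) ^ 2 := by
      have h2 : ((m / 2 : ℕ) : ℝ) + 1 ≤ (((R + 1) ^ 2 : ℕ) : ℝ) := by exact_mod_cast hR1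
      have h3 := cast_le_two_mul_div_two_add_one m
      push_cast at h2
      linarith
    calc Real.sqrt ((m : ℝ) / 2) ≤ Real.sqrt (((R : ℝ) + 1) ^ 2) := Real.sqrt_le_sqrt h1
      _ = (R : ℝ) + 1 := Real.sqrt_sq (by positivity)
  have hpos : (0 : ℝ) < 2 * Real.sqrt 2 := by positivity
  calc (m : ℝ) * Real.sqrt m / (2 * Real.sqrt 2) = Real.sqrt m / Real.sqrt 2 * ((m : ℝ) / 2) := by
        field_simp
    _ ≤ ((R : ℝ) + 1) * ((m - R ^ 2 : ℕ) : ℝ) :=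
        mul_le_mul hroot hsub (by positivity) (by positivity)
    _ = (((R + 1) * (m - R ^ 2) : ℕ) : ℝ) := by push_cast; ring
    _ ≤ ((∑ x ∈ S, (x.1 + x.2 + 1) : ℕ) : ℝ) := by exact_mod_cast key
    _ = ∑ x ∈ S, ((x.1 + x.2 + 1 : ℕ) : ℝ) := by rw [Nat.cast_sum]

/-! ## §3 Births of one genealogy at one step -/

/-- **CLASSES AT ONE STEP.**  The births of an event set `E` at step `t` have pairwise distinct classes
(`fat_injOn_birthsAt`), so `n·√n ∕ (2√2) ≤ Σ_{births at t} (d′ + 1)` with `n = #birthsAt E t`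
(indeed `Σ (d′+1) ≥ n(n+1)∕2`). [folklore] -/
theorem card_mul_sqrt_le_sum_fat_birthsAt (E : Finset PEv) (t : ℕ) :
    ((birthsAt E t).card : ℝ) * Real.sqrt (birthsAt E t).card / (2 * Real.sqrt 2) ≤
      ∑ e ∈ birthsAt E t, ((e.fat : ℝ) + 1) := by
  set n := (birthsAt E t).card with hn
  have h1 := card_mul_pred_le_two_mul_sum ((birthsAt E t).image PEv.fat)
  rw [card_image_fat_birthsAt, ← hn] at h1
  have h4 : ((n * (n - 1) : ℕ) : ℝ) = (n : ℝ) * n - n := by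
    rcases Nat.eq_zero_or_pos n with h0 | hpos
    · simp [h0]
    · rw [Nat.cast_mul, Nat.cast_sub hpos]
      push_cast
      ring
  have h1' : ((n * (n - 1) : ℕ) : ℝ) ≤ 2 * ∑ d ∈ (birthsAt E t).image PEv.fat, (d : ℝ) := by
    have h := (Nat.cast_le (α := ℝ)).2 h1
    simpa [Nat.cast_sum] using h
  have h2 : (n : ℝ) * n - n ≤ 2 * ∑ e ∈ birthsAt E t, (e.fat : ℝ) := by
    rw [← sum_image_fat_birthsAt, ← h4]
    exact h1'
  have h3 : ∑ e ∈ birthsAt E t, ((e.fat : ℝ) + 1) = ∑ e ∈ birthsAt E t, (e.fat : ℝ) + n := by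
    rw [sum_add_distrib, sum_const, nsmul_eq_mul, mul_one]
  rw [h3]
  -- `n√n/(2√2) ≤ n·n/2 ≤ n(n-1)/2 + n`
  have hsq : Real.sqrt n ≤ (n : ℝ) := by
    rcases Nat.eq_zero_or_pos n with h0 | hpos
    · simp [h0]
    · have h1' : (1 : ℝ) ≤ n := by exact_mod_cast hpos
      calc Real.sqrt n ≤ Real.sqrt n * Real.sqrt n :=
            le_mul_of_one_le_right (Real.sqrt_nonneg _) (by rwa [Real.one_le_sqrt])
        _ = n := Real.mul_self_sqrt (Nat.cast_nonneg n)
  have h5 : (n : ℝ) * Real.sqrt n / (2 * Real.sqrt 2) ≤ (n : ℝ) * n / 2 := by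
    rw [div_le_div_iff₀ (by positivity) (by positivity)]
    have h6 : (1 : ℝ) ≤ Real.sqrt 2 := by
      rw [Real.one_le_sqrt]; norm_num
    have h7 : (0 : ℝ) ≤ n := Nat.cast_nonneg n
    calc (n : ℝ) * Real.sqrt n * 2 ≤ (n : ℝ) * n * 2 := by nlinarith [Real.sqrt_nonneg (n : ℝ)]
      _ ≤ (n : ℝ) * n * (2 * Real.sqrt 2) := by nlinarith
  linarith

/-! ## §4 Mergers at one step: the younger roots are distinct births -/

/-- The pair `(age, class)` read off the assigned birth `y e` of a merger at step `s`. [folklore] -/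
def agePair (s : ℕ) (y : PEv → PEv) (e : PEv) : ℕ × ℕ := (s + 1 - (y e).step, (y e).fat)

/-- An event of kind `0` is determined by its step and its class. [folklore] -/
theorem eq_of_kind_zero {u v : PEv} (hu : u.kind = 0) (hv : v.kind = 0) (hs : u.step = v.step) (hf : u.fat = v.fat) :
    u = v := by
  obtain ⟨a, k, d⟩ := u
  obtain ⟨a', k', d'⟩ := v
  simp only [PEv.step_mk, PEv.kind_mk, PEv.fat_mk] at hu hv hs hf
  subst hs; subst hf; subst hu; subst hv; rfl

/-- With an injective assignment of births with `step ≤ s + 1`, the `(age, class)` pairs of the mergers at step `s`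
are pairwise distinct. [folklore] -/
theorem injOn_agePair (s : ℕ) (Ms : Finset PEv) (y : PEv → PEv) (hy : Set.InjOn y ↑Ms)
    (hkind : ∀ e ∈ Ms, (y e).kind = 0) (hstep : ∀ e ∈ Ms, (y e).step ≤ s + 1) :
    Set.InjOn (agePair s y) ↑Ms := by
  intro e he e' he' h
  rw [mem_coe] at he he'
  simp only [agePair, Prod.mk.injEq] at h
  have hs : (y e).step = (y e').step := by
    have h1 := hstep e he
    have h2 := hstep e' he'
    omega
  exact hy (mem_coe.2 he) (mem_coe.2 he') (eq_of_kind_zero (hkind e he) (hkind e' he') hs h.2)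

/-- **YOUNGER-ROOT BUDGET.**  Mergers `Ms` at step `s` with an injective assignment `y` of births with
`step (y e) ≤ s + 1` (in the count chain: the younger root, `partnerAges` paying its age): for all rates `ε, θ > 0`,
`min(ε, θ∕2) · #Ms·√#Ms ∕ (2√2) ≤ Σ_{e ∈ Ms} (ε·(s + 1 − step (y e)) + (θ∕2)·(fat (y e) + 1))`. [folklore] -/
theorem youngerRoot_budget {ε θ : ℝ} (hε : 0 ≤ ε) (hθ : 0 ≤ θ) (s : ℕ) (Ms : Finset PEv) (y : PEv → PEv)
    (hy : Set.InjOn y ↑Ms) (hkind : ∀ e ∈ Ms, (y e).kind = 0) (hstep : ∀ e ∈ Ms, (y e).step ≤ s + 1) :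
    min ε (θ / 2) * ((Ms.card : ℝ) * Real.sqrt Ms.card / (2 * Real.sqrt 2)) ≤
      ∑ e ∈ Ms, (ε * ((s + 1 - (y e).step : ℕ) : ℝ) + θ / 2 * ((y e).fat + 1)) := by
  have hinj := injOn_agePair s Ms y hy hkind hstep
  set T := Ms.image (agePair s y) with hT
  have hcard : T.card = Ms.card := card_image_of_injOn hinj
  have h1 := card_mul_sqrt_le_sum T
  rw [hcard] at h1
  have h2 : ∑ x ∈ T, ((x.1 + x.2 + 1 : ℕ) : ℝ) = ∑ e ∈ Ms, (((s + 1 - (y e).step) + (y e).fat + 1 : ℕ) : ℝ) := by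
    rw [hT, sum_image fun _ hx _ hx' h => hinj hx hx' h]
    rfl
  have hμ : 0 ≤ min ε (θ / 2) := le_min hε (by linarith)
  calc min ε (θ / 2) * ((Ms.card : ℝ) * Real.sqrt Ms.card / (2 * Real.sqrt 2))
      ≤ min ε (θ / 2) * ∑ e ∈ Ms, (((s + 1 - (y e).step) + (y e).fat + 1 : ℕ) : ℝ) := by
        rw [← h2]; exact mul_le_mul_of_nonneg_left h1 hμ
    _ = ∑ e ∈ Ms, min ε (θ / 2) * (((s + 1 - (y e).step) + (y e).fat + 1 : ℕ) : ℝ) := by rw [mul_sum]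
    _ ≤ ∑ e ∈ Ms, (ε * ((s + 1 - (y e).step : ℕ) : ℝ) + θ / 2 * ((y e).fat + 1)) := sum_le_sum fun e _ => by
        have ha : (0 : ℝ) ≤ ((s + 1 - (y e).step : ℕ) : ℝ) := Nat.cast_nonneg _
        have hf : (0 : ℝ) ≤ ((y e).fat : ℝ) + 1 := by positivity
        have hm1 : min ε (θ / 2) ≤ ε := min_le_left _ _
        have hm2 : min ε (θ / 2) ≤ θ / 2 := min_le_right _ _
        push_cast
        nlinarith

/-! ## §5 Sanity (decided ∕ closed instances; not used elsewhere) -/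

namespace Sanity

/-- the six pairs with `a + f ≤ 2` sum to `(0+1+2)·… = 10 + 6`; the lemma at `R = 2` claims `3·(6 − 4) = 6 ≤ 16` -/
theorem pairs_example :
    (2 + 1) * (({(0,0), (0,1), (1,0), (0,2), (1,1), (2,0)} : Finset (ℕ × ℕ)).card - 2 ^ 2) ≤
      ∑ x ∈ ({(0,0), (0,1), (1,0), (0,2), (1,1), (2,0)} : Finset (ℕ × ℕ)), (x.1 + x.2 + 1) := by decide

/-- two events of kind `0` with equal step and class are equal -/
theorem kind_zero_example : ((3, 0, 7) : PEv) = (3, 0, 7) := eq_of_kind_zero rfl rfl rfl rfl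

end Sanity

end

end Summit.QuantumFields.BalabanUV.T4Continuum.Crowding
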